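import Literature.Analysis.FluidPDE.NavierStokesConcentrationCorrector
import Literature.Analysis.FluidPDE.NavierStokesConcentrationTools
import HarnessLib

/-!
# The glued triple of the Cheskidov–Luo concentration step and its `L¹_t L^r_x` stress bound

Second file of the proof of Cheskidov–Luo 2022, Prop. 3.1 (`Torus.CheskidovLuo2022Concentration`)
from the corrector fact `Torus.CheskidovLuo2022Corrector` (A. Cheskidov, X. Luo, *Sharp
nonuniqueness for the Navier–Stokes equations*, Invent. Math. 229 (2022) = arXiv:2009.06596, §3).
Everything here is PROVED.

## Contents (namespace `Torus.Concentration`)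

* `glueVel`, `gluePres`, `glueStress` — the glued velocity `ū = u + ∑ᵢ χᵢvᵢ`, pressure
  `p̄ = p + ∑ᵢ χᵢqᵢ - ∑ᵢ (χᵢ² - χᵢ)(|vᵢ|²/d - ⨍|vᵢ|²/d) - ∑ᵢ χᵢ'πᵢ` and concentrated stress
  `R̄ = (1 - ∑ᵢχᵢ)R + ∑ᵢ χᵢ'Aᵢ + ∑ᵢ (χᵢ² - χᵢ) vᵢ ⊗̊ vᵢ` of CL22, §3.2 and (3.6), with the
  antidivergence `Aᵢ` (`vᵢ = div Aᵢ + ∇πᵢ`) of the corrector in place of `ℛvᵢ`, and the mean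
  of `|vᵢ|²/d` subtracted to keep the pressure normalisation of `Torus.IsNSReynoldsOn`.
* `IsGlueData` — the hypotheses: a zero-mean `Torus.IsNSReynoldsOn (Icc 0 T) 1` background, a
  grid `tᵢ = iT/n`, a scale `0 < τ ≤ (T/n)/2`, and a `Torus.IsCorrector` on each grid interval.
* `IsGlueData.isNSReynoldsOn` — **the glued triple solves the Navier–Stokes–Reynolds system on
  `[0, T]`** (CL22, §3.2: "we can conclude that `∂ₜū - Δū + div(ū ⊗ ū) + ∇p̄ = div R̄`"):
  smoothness by the cut-off gluing lemmas, the momentum equation by collapsing all sums at a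
  time of the `i`-th grid interval to their `i`-th term and the algebra
  `(eq. of u) + χᵢ·(eq. (3.2) of vᵢ)` (tactic `module`), zero means and trace/symmetry directly;
  `hasZeroMean_glueVel`, `glueVel_zero` (`ū(0) = u(0)`), `norm_glueVel_sub_le` (`‖ū - u‖ ≤ δ`).
* `IsGlueData.eLqLpNorm_glueStress_le` — **the bound of Prop. 3.3** in the form
  `‖R̄‖_{L¹(0,T;L^r)} ≤ (M_R + 2δ²)·2nτ + 4M_S C ‖R‖_{L¹(0,T;L^r)} + 4M_S n K`
  (`M_R = sup‖R‖`, `K` the additive constant of the corrector bound): Minkowski slice-wise, the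
  background and quadratic terms live on the `2nτ`-small set `nearNodes`, and
  `‖χⱼ'‖_{L¹} ≤ 4M_S`; mixed norms of smooth fields are genuine integrals
  (`eLqLpNorm_one_eq_lintegral`, `eLqLpNorm_one_eq_ofReal_integral`).

## References

* A. Cheskidov, X. Luo, *Sharp nonuniqueness for the Navier–Stokes equations*, Invent. Math. 229
  (2022), 987–1054; arXiv:2009.06596: §3.2, (3.6), Prop. 3.3 and its proof. [`CheskidovLuo2022`]
-/

open MeasureTheory Set Filter Topology
open scoped InnerProductSpace ContDiff ENNReal NNReal

noncomputable section

namespace Literature.Analysis.FluidPDE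

namespace Torus

section GluedTriple

namespace Concentration

open FunctionSpaces.Torus

variable {d : Type*} [Fintype d] [DecidableEq d]

/-! ## The glued triple (CL22, §3.2) -/

section Glue

variable {T τ r C K δ : ℝ} {n : ℕ}
  {u : ℝ → UnitAddTorus d → EuclideanSpace ℝ d} {P : ℝ → UnitAddTorus d → ℝ}
  {R : ℝ → UnitAddTorus d → d → EuclideanSpace ℝ d}
  {v : ℕ → ℝ → UnitAddTorus d → EuclideanSpace ℝ d} {q : ℕ → ℝ → UnitAddTorus d → ℝ}
  {A : ℕ → ℝ → UnitAddTorus d → d → EuclideanSpace ℝ d} {π : ℕ → ℝ → UnitAddTorus d → ℝ}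

/-- **The glued velocity** `ū = u + ∑ᵢ χᵢ vᵢ` (CL22, §3.2: "`ū := u + ∑ᵢ χᵢvᵢ = u + w̄`").
[cite: CheskidovLuo2022, §3.2] -/
def glueVel (T : ℝ) (n : ℕ) (τ : ℝ) (u : ℝ → UnitAddTorus d → EuclideanSpace ℝ d)
    (v : ℕ → ℝ → UnitAddTorus d → EuclideanSpace ℝ d) : ℝ → UnitAddTorus d → EuclideanSpace ℝ d :=
  fun t x => u t x + ∑ i ∈ Finset.range n, cutoff T n τ i t • v i t x

/-- The local kinetic-energy density `|vᵢ|²/d` of a corrector, whose mean has to be subtracted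
from the glued pressure to keep the pressure normalisation `∫ p = 0`. [folklore] -/
def sqDensity (w : ℝ → UnitAddTorus d → EuclideanSpace ℝ d) : ℝ → UnitAddTorus d → ℝ :=
  fun t x => ‖w t x‖ ^ 2 / Fintype.card d

/-- **The glued pressure**
`p̄ = p + ∑ᵢ χᵢ qᵢ - ∑ᵢ (χᵢ² - χᵢ)(|vᵢ|²/d - ⨍|vᵢ|²/d) - ∑ᵢ χᵢ' πᵢ` (CL22, §3.2:
"`p̄ = p + ∑ᵢ χᵢqᵢ - ∑ᵢ (χᵢ² - χᵢ)|vᵢ|²/d`"; the mean is subtracted to keep `∫ p̄ = 0`, and the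
term `-∑ᵢ χᵢ'πᵢ` accounts for the gradient part of the antidivergence `vᵢ = div Aᵢ + ∇πᵢ`).
[cite: CheskidovLuo2022, §3.2] -/
def gluePres (T : ℝ) (n : ℕ) (τ : ℝ) (P : ℝ → UnitAddTorus d → ℝ)
    (v : ℕ → ℝ → UnitAddTorus d → EuclideanSpace ℝ d) (q π : ℕ → ℝ → UnitAddTorus d → ℝ) :
    ℝ → UnitAddTorus d → ℝ :=
  fun t x => P t x + ∑ i ∈ Finset.range n,
    (cutoff T n τ i t • q i t x -
      (cutoff T n τ i t ^ 2 - cutoff T n τ i t) • (sqDensity (v i) t x - ∫ y, sqDensity (v i) t y) -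
      deriv (cutoff T n τ i) t • π i t x)

/-- **The concentrated stress** `R̄ = (1 - ∑ᵢ χᵢ) R + ∑ᵢ χᵢ' Aᵢ + ∑ᵢ (χᵢ² - χᵢ) vᵢ ⊗̊ vᵢ`
(CL22, §3.2, (3.6): "`R̄ := (1 - ∑ᵢχᵢ)R + ℛ∑ᵢ ∂ₜχᵢvᵢ + ∑ᵢ (χᵢ² - χᵢ)vᵢ ⊗̊ vᵢ`", with the
antidivergence `Aᵢ` of the corrector in place of `ℛvᵢ`). [cite: CheskidovLuo2022, §3.2 (3.6)] -/
def glueStress (T : ℝ) (n : ℕ) (τ : ℝ) (R : ℝ → UnitAddTorus d → d → EuclideanSpace ℝ d)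
    (v : ℕ → ℝ → UnitAddTorus d → EuclideanSpace ℝ d)
    (A : ℕ → ℝ → UnitAddTorus d → d → EuclideanSpace ℝ d) :
    ℝ → UnitAddTorus d → d → EuclideanSpace ℝ d :=
  fun t x j => R t x j + ∑ i ∈ Finset.range n,
    (-(cutoff T n τ i t) • R t x j + deriv (cutoff T n τ i) t • A i t x j +
      (cutoff T n τ i t ^ 2 - cutoff T n τ i t) • tracelessSq (v i t) x j)

/-- **Hypotheses of the gluing** (CL22, §§3.1–3.2): a smooth zero-mean solution `(u, P, R)` of
the Navier–Stokes–Reynolds system on `[0, T]`, a grid `tᵢ = iT/n` (`n ≥ 1`), a scale `τ > 0`,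
and a corrector `(vᵢ, qᵢ, Aᵢ, πᵢ)` on every grid interval (`Torus.IsCorrector`). [cite: CheskidovLuo2022, §§3.1–3.2] -/
structure IsGlueData (T : ℝ) (n : ℕ) (τ r C K δ : ℝ)
    (u : ℝ → UnitAddTorus d → EuclideanSpace ℝ d) (P : ℝ → UnitAddTorus d → ℝ)
    (R : ℝ → UnitAddTorus d → d → EuclideanSpace ℝ d)
    (v : ℕ → ℝ → UnitAddTorus d → EuclideanSpace ℝ d) (q : ℕ → ℝ → UnitAddTorus d → ℝ)
    (A : ℕ → ℝ → UnitAddTorus d → d → EuclideanSpace ℝ d) (π : ℕ → ℝ → UnitAddTorus d → ℝ) : Prop where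
  /-- Positive final time. -/
  hT : 0 < T
  /-- At least one grid interval. -/
  hn : 0 < n
  /-- Positive scale. -/
  hτ : 0 < τ
  /-- The scale is small compared with the grid step (transition windows do not overlap). -/
  hτn : 2 * τ ≤ T / n
  /-- Positive dimension. -/
  hd : 0 < Fintype.card d
  /-- The background solves the Navier–Stokes–Reynolds system on `[0, T]`. -/
  nsr : IsNSReynoldsOn (Icc 0 T) 1 u P R
  /-- The background velocity has zero mean. -/
  mean : ∀ t ∈ Icc 0 T, FunctionSpaces.Torus.HasZeroMean (u t)
  /-- A corrector on every grid interval. -/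
  cor : ∀ i, i < n → IsCorrector u R r C K δ (node T n i) (node T n (i + 1)) (v i) (q i) (A i) (π i)

variable (h : IsGlueData T n τ r C K δ u P R v q A π)
include h

/-- `T ≥ 0`. [folklore] -/
theorem IsGlueData.hT' : 0 ≤ T := h.hT.le

/-- The grid step `T/n` is positive. [folklore] -/
theorem IsGlueData.step_pos : 0 < T / n := div_pos h.hT (by exact_mod_cast h.hn)

/-- Consecutive nodes are distinct. [folklore] -/
theorem IsGlueData.node_lt (i : ℕ) : node T n i < node T n (i + 1) :=
  node_lt_node h.hT h.hn (Nat.lt_succ_self i)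

/-- Grid intervals lie in `[0, T]`. [folklore] -/
theorem IsGlueData.Icc_subset {i : ℕ} (hi : i < n) : Icc (node T n i) (node T n (i + 1)) ⊆ Icc 0 T := by
  intro t ht
  have h0 : 0 ≤ node T n i := by
    have := node_mono h.hT' n (Nat.zero_le i); rwa [node_zero] at this
  have h1 : node T n (i + 1) ≤ T := by
    have := node_mono h.hT' n (Nat.succ_le_of_lt hi); rwa [node_self T h.hn.ne'] at this
  exact ⟨h0.trans ht.1, ht.2.trans h1⟩

/-- The scale is below the grid step. [folklore] -/
theorem IsGlueData.τ_lt_step : τ < T / n := by linarith [h.hτ, h.hτn]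

/-- Grid intervals are sets of unique differentiability. [folklore] -/
theorem IsGlueData.uniqueDiffOn (i : ℕ) : UniqueDiffOn ℝ (Icc (node T n i) (node T n (i + 1))) :=
  uniqueDiffOn_Icc (h.node_lt i)

/-! ### Admissible cut-offs attached to the grid -/

/-- `χᵢ` is an admissible cut-off for the `i`-th grid interval. [folklore] -/
theorem IsGlueData.isTimeCutoff {i : ℕ} (hi : i < n) :
    IsTimeCutoff (Icc 0 T) (node T n i) (node T n (i + 1)) (cutoff T n τ i) :=
  isTimeCutoff_cutoff h.hτ h.hn hi

/-- `χᵢ'` is an admissible cut-off as well. [folklore] -/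
theorem IsGlueData.isTimeCutoff_deriv {i : ℕ} (hi : i < n) :
    IsTimeCutoff (Icc 0 T) (node T n i) (node T n (i + 1)) (deriv (cutoff T n τ i)) where
  contDiff := (contDiff_cutoff T n τ i).deriv'
  left := by
    by_cases h0 : i = 0
    · left; subst h0; rw [node_zero]; exact fun t ht => ht.1
    · right
      refine ⟨node T n i + τ / 4, by linarith [h.hτ], fun t ht => ?_⟩
      have := h.τ_lt_step
      exact deriv_cutoff_eq_zero h.hτ (Or.inr (Or.inl (by linarith [h.hτ])))
        (Or.inr (Or.inl (by rw [node_succ]; linarith [h.hτ])))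
  right := by
    by_cases hl : i + 1 = n
    · left; rw [hl, node_self T h.hn.ne']; exact fun t ht => ht.2
    · right
      refine ⟨node T n (i + 1) - τ / 4, by linarith [h.hτ], fun t ht => ?_⟩
      have := h.τ_lt_step
      exact deriv_cutoff_eq_zero h.hτ (Or.inr (Or.inr (by rw [node_succ] at ht; linarith [h.hτ])))
        (Or.inr (Or.inr (by linarith [h.hτ])))

/-- `χᵢ² - χᵢ` is an admissible cut-off as well. [folklore] -/
theorem IsGlueData.isTimeCutoff_sq_sub {i : ℕ} (hi : i < n) :
    IsTimeCutoff (Icc 0 T) (node T n i) (node T n (i + 1))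
      (fun t => cutoff T n τ i t ^ 2 - cutoff T n τ i t) where
  contDiff := ((contDiff_cutoff T n τ i).pow 2).sub (contDiff_cutoff T n τ i)
  left := by
    rcases (h.isTimeCutoff hi).left with hl | ⟨a', ha', hz⟩
    · exact Or.inl hl
    · exact Or.inr ⟨a', ha', fun t ht => by simp [hz t ht]⟩
  right := by
    rcases (h.isTimeCutoff hi).right with hr | ⟨b', hb', hz⟩
    · exact Or.inl hr
    · exact Or.inr ⟨b', hb', fun t ht => by simp [hz t ht]⟩

/-- `-χᵢ` is an admissible cut-off as well. [folklore] -/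
theorem IsGlueData.isTimeCutoff_neg {i : ℕ} (hi : i < n) :
    IsTimeCutoff (Icc 0 T) (node T n i) (node T n (i + 1)) (fun t => -cutoff T n τ i t) where
  contDiff := (contDiff_cutoff T n τ i).neg
  left := by
    rcases (h.isTimeCutoff hi).left with hl | ⟨a', ha', hz⟩
    · exact Or.inl hl
    · exact Or.inr ⟨a', ha', fun t ht => by simp [hz t ht]⟩
  right := by
    rcases (h.isTimeCutoff hi).right with hr | ⟨b', hb', hz⟩
    · exact Or.inl hr
    · exact Or.inr ⟨b', hb', fun t ht => by simp [hz t ht]⟩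

/-! ### Smoothness of the corrector-built fields on their intervals -/

/-- `|vᵢ|²/d` is jointly smooth on the `i`-th grid interval. [folklore] -/
theorem IsGlueData.smooth_sqDensity {i : ℕ} (hi : i < n) :
    FunctionSpaces.Torus.IsSmoothSpaceTimeOn (Icc (node T n i) (node T n (i + 1))) (sqDensity (v i)) := by
  have h1 := ((h.cor i hi).smooth_v.inner (h.cor i hi).smooth_v).mul
    (isSmoothSpaceTimeOn_const (S := Icc (node T n i) (node T n (i + 1)))
      (isSmooth_const ((Fintype.card d : ℝ)⁻¹)))
  refine ContDiffOn.congr h1 fun p _ => ?_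
  simp [sqDensity, stLift, div_eq_mul_inv]

/-- `|vᵢ|²/d - ⨍|vᵢ|²/d` is jointly smooth on the `i`-th grid interval. [folklore] -/
theorem IsGlueData.smooth_sqDensity_sub {i : ℕ} (hi : i < n) :
    FunctionSpaces.Torus.IsSmoothSpaceTimeOn (Icc (node T n i) (node T n (i + 1)))
      (fun t x => sqDensity (v i) t x - ∫ y, sqDensity (v i) t y) :=
  (h.smooth_sqDensity hi).sub ((h.smooth_sqDensity hi).integral_const (h.uniqueDiffOn i) (convex_Icc _ _))

/-- `vᵢ ⊗̊ vᵢ` is jointly smooth on the `i`-th grid interval. [folklore] -/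
theorem IsGlueData.smooth_tracelessSq {i : ℕ} (hi : i < n) :
    FunctionSpaces.Torus.IsSmoothSpaceTimeOn (Icc (node T n i) (node T n (i + 1)))
      (fun t => tracelessSq (v i t)) := by
  have hv := (h.cor i hi).smooth_v
  have hsq := h.smooth_sqDensity hi
  have hcomp : ∀ j : d, FunctionSpaces.Torus.IsSmoothSpaceTimeOn (Icc (node T n i) (node T n (i + 1)))
      (fun t x => v i t x j • v i t x - sqDensity (v i) t x • (EuclideanSpace.single j (1 : ℝ) : EuclideanSpace ℝ d)) :=
    fun j => ((hv.apply j).smul hv).sub (hsq.smul (isSmoothSpaceTimeOn_const (isSmooth_const _) _))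
  have : FunctionSpaces.Torus.IsSmoothSpaceTimeOn (Icc (node T n i) (node T n (i + 1)))
      (fun t x => fun j => v i t x j • v i t x - sqDensity (v i) t x • (EuclideanSpace.single j (1 : ℝ) : EuclideanSpace ℝ d)) :=
    contDiffOn_pi.2 fun j => hcomp j
  exact this

/-! ### Smoothness of the glued fields on `[0, T]` -/

/-- The glued velocity is jointly smooth on `[0, T]` (CL22, §3.2). [cite: CheskidovLuo2022, §3.2] -/
theorem IsGlueData.smooth_glueVel :
    FunctionSpaces.Torus.IsSmoothSpaceTimeOn (Icc 0 T) (glueVel T n τ u v) :=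
  h.nsr.smooth_velocity.add (IsSmoothSpaceTimeOn.sum fun i hi =>
    (h.isTimeCutoff (Finset.mem_range.1 hi)).isSmoothSpaceTimeOn_smul
      (h.cor i (Finset.mem_range.1 hi)).smooth_v)

/-- The glued pressure is jointly smooth on `[0, T]`. [cite: CheskidovLuo2022, §3.2] -/
theorem IsGlueData.smooth_gluePres :
    FunctionSpaces.Torus.IsSmoothSpaceTimeOn (Icc 0 T) (gluePres T n τ P v q π) := by
  refine h.nsr.smooth_pressure.add (IsSmoothSpaceTimeOn.sum fun i hi => ?_)
  have hi' := Finset.mem_range.1 hi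
  exact (((h.isTimeCutoff hi').isSmoothSpaceTimeOn_smul (h.cor i hi').smooth_q).sub
    ((h.isTimeCutoff_sq_sub hi').isSmoothSpaceTimeOn_smul (h.smooth_sqDensity_sub hi'))).sub
    ((h.isTimeCutoff_deriv hi').isSmoothSpaceTimeOn_smul (h.cor i hi').smooth_π)

/-- The concentrated stress is jointly smooth on `[0, T]`. [cite: CheskidovLuo2022, §3.2] -/
theorem IsGlueData.smooth_glueStress :
    FunctionSpaces.Torus.IsSmoothSpaceTimeOn (Icc 0 T) (glueStress T n τ R v A) := by
  have hsum : FunctionSpaces.Torus.IsSmoothSpaceTimeOn (Icc 0 T) (fun t x => ∑ i ∈ Finset.range n,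
      (-(cutoff T n τ i t) • R t x + deriv (cutoff T n τ i) t • A i t x +
        (cutoff T n τ i t ^ 2 - cutoff T n τ i t) • tracelessSq (v i t) x)) := by
    refine IsSmoothSpaceTimeOn.sum fun i hi => ?_
    have hi' := Finset.mem_range.1 hi
    exact (((h.isTimeCutoff_neg hi').isSmoothSpaceTimeOn_smul (h.nsr.smooth_stress.mono (h.Icc_subset hi'))).add
      ((h.isTimeCutoff_deriv hi').isSmoothSpaceTimeOn_smul (h.cor i hi').smooth_A)).add
      ((h.isTimeCutoff_sq_sub hi').isSmoothSpaceTimeOn_smul (h.smooth_tracelessSq hi'))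
  have := h.nsr.smooth_stress.add hsum
  refine ContDiffOn.congr this fun p _ => ?_
  funext j
  simp [glueStress, stLift, Finset.sum_apply]

/-! ### Collapse of the sums at a given time -/

omit h in
/-- At a time of the `i`-th grid interval only the `i`-th cut-off (and its derivative) can be
non-zero, so every sum over the cut-offs collapses to its `i`-th term. [folklore] -/
theorem sum_collapse {β : Type*} [AddCommMonoid β] (hT : 0 ≤ T) (hτ : 0 < τ) {i : ℕ} (hi : i < n)
    {t : ℝ} (ht : t ∈ Icc (node T n i) (node T n (i + 1))) (F : ℕ → ℝ → ℝ → β)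
    (hF : ∀ j, F j 0 0 = 0) :
    ∑ j ∈ Finset.range n, F j (cutoff T n τ j t) (deriv (cutoff T n τ j) t) =
      F i (cutoff T n τ i t) (deriv (cutoff T n τ i) t) := by
  refine Finset.sum_eq_single_of_mem i (Finset.mem_range.2 hi) fun j _ hji => ?_
  rw [cutoff_eq_zero_of_ne hT hτ hi hji ht, deriv_cutoff_eq_zero_of_ne hT hτ hi hji ht, hF j]

/-- The glued velocity at a time of the `i`-th grid interval: `ū = u + χᵢvᵢ`. [folklore] -/
theorem IsGlueData.glueVel_apply {i : ℕ} (hi : i < n) {t : ℝ}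
    (ht : t ∈ Icc (node T n i) (node T n (i + 1))) (x : UnitAddTorus d) :
    glueVel T n τ u v t x = u t x + cutoff T n τ i t • v i t x := by
  unfold glueVel
  rw [sum_collapse h.hT' h.hτ hi ht (fun j c _ => c • v j t x) fun j => by simp]

/-- The glued pressure at a time of the `i`-th grid interval. [folklore] -/
theorem IsGlueData.gluePres_apply {i : ℕ} (hi : i < n) {t : ℝ}
    (ht : t ∈ Icc (node T n i) (node T n (i + 1))) (x : UnitAddTorus d) :
    gluePres T n τ P v q π t x = P t x + (cutoff T n τ i t • q i t x -
      (cutoff T n τ i t ^ 2 - cutoff T n τ i t) • (sqDensity (v i) t x - ∫ y, sqDensity (v i) t y) -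
      deriv (cutoff T n τ i) t • π i t x) := by
  unfold gluePres
  rw [sum_collapse h.hT' h.hτ hi ht (fun j c c' => c • q j t x -
      (c ^ 2 - c) • (sqDensity (v j) t x - ∫ y, sqDensity (v j) t y) - c' • π j t x) fun j => by simp]

/-- The concentrated stress at a time of the `i`-th grid interval:
`R̄ = (1 - χᵢ)R + χᵢ'Aᵢ + (χᵢ² - χᵢ)vᵢ ⊗̊ vᵢ`. [cite: CheskidovLuo2022, §3.2 (3.6)] -/
theorem IsGlueData.glueStress_apply {i : ℕ} (hi : i < n) {t : ℝ}
    (ht : t ∈ Icc (node T n i) (node T n (i + 1))) (x : UnitAddTorus d) (j : d) :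
    glueStress T n τ R v A t x j = R t x j + (-(cutoff T n τ i t) • R t x j +
      deriv (cutoff T n τ i) t • A i t x j +
      (cutoff T n τ i t ^ 2 - cutoff T n τ i t) • tracelessSq (v i t) x j) := by
  unfold glueStress
  rw [sum_collapse h.hT' h.hτ hi ht (fun k c c' => -c • R t x j + c' • A k t x j +
      (c ^ 2 - c) • tracelessSq (v k t) x j) fun k => by simp]

/-- The time derivative of the glued velocity within `[0, T]`. [folklore] -/
theorem IsGlueData.timeDerivWithin_glueVel {i : ℕ} (hi : i < n) {t : ℝ}
    (ht : t ∈ Icc (node T n i) (node T n (i + 1))) (x : UnitAddTorus d) :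
    FunctionSpaces.Torus.timeDerivWithin (Icc 0 T) (glueVel T n τ u v) t x =
      FunctionSpaces.Torus.timeDerivWithin (Icc 0 T) u t x +
        (deriv (cutoff T n τ i) t • v i t x + cutoff T n τ i t •
          FunctionSpaces.Torus.timeDerivWithin (Icc (node T n i) (node T n (i + 1))) (v i) t x) := by
  have htT : t ∈ Icc 0 T := h.Icc_subset hi ht
  have hsum : HasDerivWithinAt (fun s => ∑ j ∈ Finset.range n, cutoff T n τ j s • v j s x)
      (∑ j ∈ Finset.range n, (deriv (cutoff T n τ j) t • v j t x + cutoff T n τ j t •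
        FunctionSpaces.Torus.timeDerivWithin (Icc (node T n j) (node T n (j + 1))) (v j) t x)) (Icc 0 T) t :=
    HasDerivWithinAt.fun_sum fun j hj =>
      (h.isTimeCutoff (Finset.mem_range.1 hj)).hasDerivWithinAt_smul
        (h.cor j (Finset.mem_range.1 hj)).smooth_v htT x
  have hu := h.nsr.smooth_velocity.hasDerivWithinAt_slice htT x
  have hall := hu.add hsum
  rw [sum_collapse h.hT' h.hτ hi ht (fun j c c' => c' • v j t x + c •
      FunctionSpaces.Torus.timeDerivWithin (Icc (node T n j) (node T n (j + 1))) (v j) t x) fun j => by simp] at hall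
  exact hall.derivWithin (uniqueDiffOn_Icc h.hT t htT)

/-! ### The glued triple solves the Navier–Stokes–Reynolds system -/

/-- The momentum equation of the glued triple at a time of the `i`-th grid interval (CL22,
§3.2, the computation leading to (3.6)). [cite: CheskidovLuo2022, §3.2] -/
theorem IsGlueData.momentum {i : ℕ} (hi : i < n) {t : ℝ}
    (ht : t ∈ Icc (node T n i) (node T n (i + 1))) (x : UnitAddTorus d) :
    FunctionSpaces.Torus.timeDerivWithin (Icc 0 T) (glueVel T n τ u v) t x +
          FunctionSpaces.Torus.convect (glueVel T n τ u v t) (glueVel T n τ u v t) x +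
        FunctionSpaces.Torus.gradient (gluePres T n τ P v q π t) x =
      (1 : ℝ) • FunctionSpaces.Torus.laplacian (glueVel T n τ u v t) x +
        tensorDivergence (glueStress T n τ R v A t) x := by
  have htT : t ∈ Icc 0 T := h.Icc_subset hi ht
  have hc := h.cor i hi
  -- abbreviations
  set c : ℝ := cutoff T n τ i t with hc_def
  set c' : ℝ := deriv (cutoff T n τ i) t with hc'_def
  set m : ℝ := ∫ y, sqDensity (v i) t y with hm_def
  -- smoothness of the slices
  have hut : IsSmooth (u t) := h.nsr.smooth_velocity.isSmooth_slice htT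
  have hPt : IsSmooth (P t) := h.nsr.smooth_pressure.isSmooth_slice htT
  have hRt : IsSmooth (R t) := h.nsr.smooth_stress.isSmooth_slice htT
  have hvt : IsSmooth (v i t) := hc.smooth_v.isSmooth_slice ht
  have hqt : IsSmooth (q i t) := hc.smooth_q.isSmooth_slice ht
  have hAt : IsSmooth (A i t) := hc.smooth_A.isSmooth_slice ht
  have hπt : IsSmooth (π i t) := hc.smooth_π.isSmooth_slice ht
  have hNt : IsSmooth (sqDensity (v i) t) := by
    have := hvt.norm_sq.div_const (Fintype.card d : ℝ)
    exact this
  -- the slices of the glued fields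
  have hV : glueVel T n τ u v t = fun x => u t x + c • v i t x := funext fun x => h.glueVel_apply hi ht x
  have hPr : gluePres T n τ P v q π t = fun x => P t x + (c • q i t x +
      ((-(c ^ 2 - c)) * (sqDensity (v i) t x + (-m)) + (-c') * π i t x)) := by
    funext x; rw [h.gluePres_apply hi ht x]; simp only [smul_eq_mul]; ring
  have hSt : glueStress T n τ R v A t = fun x j => R t x j + ((-c) • R t x j + (c' • A i t x j +
      (c ^ 2 - c) • tracelessSq (v i t) x j)) := by
    funext x j; rw [h.glueStress_apply hi ht x j, add_assoc]
  -- smoothness of the pieces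
  have hcv : IsSmooth (fun x => c • v i t x) := hvt.smul c
  have h1u : IsContDiff 1 (u t) := hut.isContDiff (by simp)
  have h1v : IsContDiff 1 (v i t) := hvt.isContDiff (by simp)
  have h1cv : IsContDiff 1 (fun x => c • v i t x) := hcv.isContDiff (by simp)
  have h1P : IsContDiff 1 (P t) := hPt.isContDiff (by simp)
  have h1q : IsContDiff 1 (q i t) := hqt.isContDiff (by simp)
  have h1π : IsContDiff 1 (π i t) := hπt.isContDiff (by simp)
  have h1N : IsContDiff 1 (sqDensity (v i) t) := hNt.isContDiff (by simp)
  have h1Nm : IsContDiff 1 (fun x => sqDensity (v i) t x + (-m)) := (hNt.add (isSmooth_const _)).isContDiff (by simp)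
  have h1cq : IsContDiff 1 (fun x => c • q i t x) := (hqt.smul c).isContDiff (by simp)
  have h1a : IsContDiff 1 (fun x => (-(c ^ 2 - c)) * (sqDensity (v i) t x + (-m))) :=
    ((hNt.add (isSmooth_const _)).smul (-(c ^ 2 - c))).isContDiff (by simp)
  have h1b : IsContDiff 1 (fun x => (-c') * π i t x) := (hπt.smul (-c')).isContDiff (by simp)
  have h1ab : IsContDiff 1 (fun x => (-(c ^ 2 - c)) * (sqDensity (v i) t x + (-m)) + (-c') * π i t x) :=
    h1a.add h1b
  have h1qab : IsContDiff 1 (fun x => c • q i t x +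
      ((-(c ^ 2 - c)) * (sqDensity (v i) t x + (-m)) + (-c') * π i t x)) := h1cq.add h1ab
  have h1R : IsContDiff 1 (R t) := hRt.isContDiff (by simp)
  have h1cR : IsContDiff 1 (fun x j => (-c) • R t x j) := (hRt.smul (-c)).isContDiff (by simp)
  have h1A : IsContDiff 1 (fun x j => c' • A i t x j) := (hAt.smul c').isContDiff (by simp)
  have h1T : IsContDiff 1 (fun x j => (c ^ 2 - c) • tracelessSq (v i t) x j) :=
    (hvt.tracelessSq.smul (c ^ 2 - c)).isContDiff (by simp)
  have h1AT : IsContDiff 1 (fun x j => c' • A i t x j + (c ^ 2 - c) • tracelessSq (v i t) x j) :=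
    h1A.add h1T
  have h1RAT : IsContDiff 1 (fun x j => (-c) • R t x j + (c' • A i t x j +
      (c ^ 2 - c) • tracelessSq (v i t) x j)) := h1cR.add h1AT
  -- the operators on the glued slices
  have eLap : FunctionSpaces.Torus.laplacian (glueVel T n τ u v t) x =
      FunctionSpaces.Torus.laplacian (u t) x + c • FunctionSpaces.Torus.laplacian (v i t) x := by
    rw [hV, laplacian_add_apply hut hcv, show (fun y => c • v i t y) = c • v i t from rfl,
      laplacian_const_smul' hvt]
  have eConv : FunctionSpaces.Torus.convect (glueVel T n τ u v t) (glueVel T n τ u v t) x =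
      FunctionSpaces.Torus.convect (u t) (u t) x + c • FunctionSpaces.Torus.convect (u t) (v i t) x +
        (c • FunctionSpaces.Torus.convect (v i t) (u t) x +
          c • (c • FunctionSpaces.Torus.convect (v i t) (v i t) x)) := by
    rw [hV, convect_add_left, convect_add_right _ h1u h1cv, convect_add_right _ h1u h1cv,
      convect_smul_right _ h1v, convect_smul_right _ h1v, convect_smul_left, convect_smul_left]
  have eGrad : FunctionSpaces.Torus.gradient (gluePres T n τ P v q π t) x =
      FunctionSpaces.Torus.gradient (P t) x + (c • FunctionSpaces.Torus.gradient (q i t) x +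
        ((-(c ^ 2 - c)) • FunctionSpaces.Torus.gradient (sqDensity (v i) t) x +
          (-c') • FunctionSpaces.Torus.gradient (π i t) x)) := by
    rw [hPr, gradient_add_apply h1P h1qab, gradient_add_apply h1cq h1ab, gradient_add_apply h1a h1b,
      gradient_const_mul_apply h1Nm, gradient_const_mul_apply h1π, gradient_add_apply h1N (isContDiff_const _),
      gradient_const, add_zero]
    rw [show (fun x => c • q i t x) = fun x => c * q i t x from rfl, gradient_const_mul_apply h1q]
  have eDiv : tensorDivergence (glueStress T n τ R v A t) x =
      tensorDivergence (R t) x + ((-c) • tensorDivergence (R t) x +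
        (c' • tensorDivergence (A i t) x + (c ^ 2 - c) • tensorDivergence (tracelessSq (v i t)) x)) := by
    rw [hSt, tensorDivergence_add_apply h1R h1RAT, tensorDivergence_add_apply h1cR h1AT,
      tensorDivergence_add_apply h1A h1T, tensorDivergence_const_smul_apply h1R,
      tensorDivergence_const_smul_apply (hAt.isContDiff (by simp)),
      tensorDivergence_const_smul_apply (hvt.tracelessSq.isContDiff (by simp))]
  have eA : tensorDivergence (A i t) x = v i t x - FunctionSpaces.Torus.gradient (π i t) x := by
    rw [hc.eq_div_add_grad t ht x, add_sub_cancel_right]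
  have eTsq : tensorDivergence (tracelessSq (v i t)) x =
      FunctionSpaces.Torus.convect (v i t) (v i t) x - FunctionSpaces.Torus.gradient (sqDensity (v i) t) x :=
    tensorDivergence_tracelessSq hvt (hc.divFree t ht) x
  -- the two equations
  have hU := h.nsr.momentum t htT x
  have hVeq := hc.momentum t ht x
  rw [h.timeDerivWithin_glueVel hi ht x, eLap, eConv, eGrad, eDiv, eA, eTsq]
  rw [one_smul] at hU ⊢
  -- linear algebra
  set Du := FunctionSpaces.Torus.timeDerivWithin (Icc 0 T) u t x
  set Dv := FunctionSpaces.Torus.timeDerivWithin (Icc (node T n i) (node T n (i + 1))) (v i) t x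
  set Cuu := FunctionSpaces.Torus.convect (u t) (u t) x
  set Cuv := FunctionSpaces.Torus.convect (u t) (v i t) x
  set Cvu := FunctionSpaces.Torus.convect (v i t) (u t) x
  set Cvv := FunctionSpaces.Torus.convect (v i t) (v i t) x
  set GP := FunctionSpaces.Torus.gradient (P t) x
  set Gq := FunctionSpaces.Torus.gradient (q i t) x
  set GN := FunctionSpaces.Torus.gradient (sqDensity (v i) t) x
  set Gπ := FunctionSpaces.Torus.gradient (π i t) x
  set Lu := FunctionSpaces.Torus.laplacian (u t) x
  set Lv := FunctionSpaces.Torus.laplacian (v i t) x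
  set DR := tensorDivergence (R t) x
  set V := v i t x
  -- `hU : Du + Cuu + GP = Lu + DR`, `hVeq : Dv + Cvv + Cuv + Cvu + Gq = Lv - DR`
  have key : Du + (c' • V + c • Dv) + (Cuu + c • Cuv + (c • Cvu + c • (c • Cvv))) +
      (GP + (c • Gq + ((-(c ^ 2 - c)) • GN + (-c') • Gπ))) -
      (Lu + c • Lv + (DR + ((-c) • DR + (c' • (V - Gπ) + (c ^ 2 - c) • (Cvv - GN))))) =
      (Du + Cuu + GP - (Lu + DR)) + c • (Dv + Cvv + Cuv + Cvu + Gq - (Lv - DR)) := by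
    module
  rw [hU, hVeq, sub_self, sub_self, smul_zero, add_zero, sub_eq_zero] at key
  exact key

/-- **The glued triple solves the Navier–Stokes–Reynolds system on `[0, T]`** (CL22, §3.2:
"we can conclude that `∂ₜū - Δū + div(ū ⊗ ū) + ∇p̄ = div R̄`"). [cite: CheskidovLuo2022, §3.2] -/
theorem IsGlueData.isNSReynoldsOn :
    IsNSReynoldsOn (Icc 0 T) 1 (glueVel T n τ u v) (gluePres T n τ P v q π) (glueStress T n τ R v A) where
  smooth_velocity := h.smooth_glueVel
  smooth_pressure := h.smooth_gluePres
  smooth_stress := h.smooth_glueStress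
  momentum t ht x := by
    obtain ⟨i, hi, hti⟩ := exists_mem_Icc_node h.hT h.hn ht
    exact h.momentum hi hti x
  divFree t ht := by
    obtain ⟨i, hi, hti⟩ := exists_mem_Icc_node h.hT h.hn ht
    have hV : glueVel T n τ u v t = fun x => u t x + cutoff T n τ i t • v i t x :=
      funext fun x => h.glueVel_apply hi hti x
    rw [hV]
    have hvt : IsSmooth (v i t) := (h.cor i hi).smooth_v.isSmooth_slice hti
    have hut : IsSmooth (u t) := h.nsr.smooth_velocity.isSmooth_slice ht
    exact IsDivFree.add (hut.isContDiff (by simp)) ((hvt.smul _).isContDiff (by simp)) (h.nsr.divFree t ht)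
      (isDivFree_const_smul (hvt.isContDiff (by simp)) ((h.cor i hi).divFree t hti) _)
  symm t ht x j k := by
    obtain ⟨i, hi, hti⟩ := exists_mem_Icc_node h.hT h.hn ht
    rw [h.glueStress_apply hi hti, h.glueStress_apply hi hti]
    simp only [PiLp.add_apply, PiLp.smul_apply, smul_eq_mul]
    rw [h.nsr.symm t ht x j k, (h.cor i hi).symm t hti x j k, tracelessSq_symm (v i t) x j k]
  traceFree t ht x := by
    obtain ⟨i, hi, hti⟩ := exists_mem_Icc_node h.hT h.hn ht
    simp_rw [h.glueStress_apply hi hti]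
    simp only [PiLp.add_apply, PiLp.smul_apply, smul_eq_mul, Finset.sum_add_distrib,
      ← Finset.mul_sum, h.nsr.traceFree t ht x, (h.cor i hi).traceFree t hti x,
      tracelessSq_traceFree h.hd (v i t) x]
    ring
  hasZeroMean_pressure t ht := by
    obtain ⟨i, hi, hti⟩ := exists_mem_Icc_node h.hT h.hn ht
    have hPr : gluePres T n τ P v q π t = fun x => P t x + (cutoff T n τ i t • q i t x -
        (cutoff T n τ i t ^ 2 - cutoff T n τ i t) • (sqDensity (v i) t x - ∫ y, sqDensity (v i) t y) -
        deriv (cutoff T n τ i) t • π i t x) := funext fun x => h.gluePres_apply hi hti x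
    rw [hPr]
    have hc := h.cor i hi
    have hvt : IsSmooth (v i t) := hc.smooth_v.isSmooth_slice hti
    have hqt : IsSmooth (q i t) := hc.smooth_q.isSmooth_slice hti
    have hπt : IsSmooth (π i t) := hc.smooth_π.isSmooth_slice hti
    have hNt : IsSmooth (sqDensity (v i) t) := by
      have := hvt.norm_sq.div_const (Fintype.card d : ℝ); exact this
    have hNi : Integrable (sqDensity (v i) t) volume := hNt.integrable
    have z1 : FunctionSpaces.Torus.HasZeroMean (fun x => cutoff T n τ i t • q i t x) :=
      hasZeroMean_const_smul (hc.hasZeroMean_q t hti) _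
    have z2 : FunctionSpaces.Torus.HasZeroMean (fun x => (cutoff T n τ i t ^ 2 - cutoff T n τ i t) •
        (sqDensity (v i) t x - ∫ y, sqDensity (v i) t y)) :=
      hasZeroMean_const_smul (hasZeroMean_sub_integral hNi) _
    have z3 : FunctionSpaces.Torus.HasZeroMean (fun x => deriv (cutoff T n τ i) t • π i t x) :=
      hasZeroMean_const_smul (hc.hasZeroMean_π t hti) _
    have i1 : Integrable (fun x => cutoff T n τ i t • q i t x) volume := (hqt.smul _).integrable
    have i2 : Integrable (fun x => (cutoff T n τ i t ^ 2 - cutoff T n τ i t) •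
        (sqDensity (v i) t x - ∫ y, sqDensity (v i) t y)) volume :=
      ((hNt.sub (isSmooth_const _)).smul _).integrable
    have i3 : Integrable (fun x => deriv (cutoff T n τ i) t • π i t x) volume := (hπt.smul _).integrable
    have z12 := z1.sub z2 i1 i2
    have z123 := z12.sub z3 (i1.sub i2) i3
    exact HasZeroMean.add (h.nsr.hasZeroMean_pressure t ht) z123
      (h.nsr.smooth_pressure.isSmooth_slice ht).integrable ((i1.sub i2).sub i3)

/-- The glued velocity has zero mean. [folklore] -/
theorem IsGlueData.hasZeroMean_glueVel {t : ℝ} (ht : t ∈ Icc 0 T) :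
    FunctionSpaces.Torus.HasZeroMean (glueVel T n τ u v t) := by
  obtain ⟨i, hi, hti⟩ := exists_mem_Icc_node h.hT h.hn ht
  have hV : glueVel T n τ u v t = fun x => u t x + cutoff T n τ i t • v i t x :=
    funext fun x => h.glueVel_apply hi hti x
  rw [hV]
  exact HasZeroMean.add (h.mean t ht) (hasZeroMean_const_smul ((h.cor i hi).hasZeroMean_v t hti) _)
    (h.nsr.smooth_velocity.isSmooth_slice ht).integrable
    ((((h.cor i hi).smooth_v.isSmooth_slice hti).smul _).integrable)

/-- The glued velocity agrees with the background at `t = 0` (the first corrector starts from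
zero data and all other cut-offs vanish near `0`). [folklore] -/
theorem IsGlueData.glueVel_zero : glueVel T n τ u v 0 = u 0 := by
  funext x
  have h0 : (0 : ℝ) ∈ Icc (node T n 0) (node T n (0 + 1)) := by
    rw [node_zero]; exact ⟨le_rfl, by have := h.node_lt 0; rw [node_zero] at this; exact this.le⟩
  rw [h.glueVel_apply h.hn h0 x]
  have := (h.cor 0 h.hn).initial x
  rw [node_zero] at this
  rw [this, smul_zero, add_zero]

/-- The glued velocity is `δ`-close to the background pointwise. [folklore] -/
theorem IsGlueData.norm_glueVel_sub_le {t : ℝ} (ht : t ∈ Icc 0 T) (x : UnitAddTorus d) :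
    ‖glueVel T n τ u v t x - u t x‖ ≤ δ := by
  obtain ⟨i, hi, hti⟩ := exists_mem_Icc_node h.hT h.hn ht
  rw [h.glueVel_apply hi hti x, add_sub_cancel_left, norm_smul]
  have hδ : 0 ≤ δ := (norm_nonneg _).trans ((h.cor i hi).norm_le t hti x)
  calc ‖cutoff T n τ i t‖ * ‖v i t x‖ ≤ 1 * δ := by
        gcongr
        · exact abs_cutoff_le_one T n τ i t
        · exact (h.cor i hi).norm_le t hti x
    _ = δ := one_mul δ

end Glue

end Concentration

end GluedTriple

section StressBound

namespace Concentration

open FunctionSpaces.Torus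

variable {d : Type*} [Fintype d] [DecidableEq d]

/-! ## Mixed `L¹_t L^p_x` norms of smooth fields as integrals -/

section MixedAsIntegral

variable {F : Type*} [NormedAddCommGroup F] [NormedSpace ℝ F] {T : ℝ} {w : ℝ → UnitAddTorus d → F}

omit [DecidableEq d] in
/-- For a jointly smooth field the mixed norm `‖w‖_{L¹(0,T;L^p)}` is the lower integral of the
slice norms (no junk: the slices have finite norm). [folklore] -/
theorem eLqLpNorm_one_eq_lintegral (hw : FunctionSpaces.Torus.IsSmoothSpaceTimeOn (Icc 0 T) w) (p : ℝ≥0∞) :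
    eLqLpNorm 1 p w (Ioo 0 T) = ∫⁻ t in Ioo 0 T, eLpNorm (w t) p volume := by
  rw [eLqLpNorm, FluidPDE.eLqLpNorm, eLpNorm_one_eq_lintegral_enorm]
  refine setLIntegral_congr_fun measurableSet_Ioo fun t ht => ?_
  rw [Real.enorm_eq_ofReal_abs, abs_of_nonneg ENNReal.toReal_nonneg,
    ENNReal.ofReal_toReal (hw.eLpNorm_slice_lt_top (Ioo_subset_Icc_self ht) p).ne]

omit [DecidableEq d] in
/-- For a jointly smooth field and `p ≥ 1`, `T ≥ 0`, the lower integral of the slice norms over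
`(0, T)` is `ofReal` of the interval integral of their real values. [folklore] -/
theorem lintegral_eLpNorm_eq_ofReal_integral (hw : FunctionSpaces.Torus.IsSmoothSpaceTimeOn (Icc 0 T) w)
    {p : ℝ≥0∞} (hp : 1 ≤ p) (hT : 0 ≤ T) :
    ∫⁻ t in Ioo 0 T, eLpNorm (w t) p volume =
      ENNReal.ofReal (∫ t in (0 : ℝ)..T, (eLpNorm (w t) p volume).toReal) := by
  have hcont := hw.continuousOn_eLpNorm_toReal hp
  have hint : IntegrableOn (fun t => (eLpNorm (w t) p volume).toReal) (Ioo 0 T) volume :=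
    (hcont.integrableOn_compact isCompact_Icc).mono_set Ioo_subset_Icc_self
  rw [intervalIntegral.integral_of_le hT, integral_Ioc_eq_integral_Ioo,
    ofReal_integral_eq_lintegral_ofReal hint (ae_of_all _ fun t => ENNReal.toReal_nonneg)]
  refine setLIntegral_congr_fun measurableSet_Ioo fun t ht => ?_
  rw [ENNReal.ofReal_toReal (hw.eLpNorm_slice_lt_top (Ioo_subset_Icc_self ht) p).ne]

omit [DecidableEq d] in
/-- The mixed norm `‖w‖_{L¹(0,T;L^p)}` of a jointly smooth field as `ofReal` of an interval
integral. [folklore] -/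
theorem eLqLpNorm_one_eq_ofReal_integral (hw : FunctionSpaces.Torus.IsSmoothSpaceTimeOn (Icc 0 T) w)
    {p : ℝ≥0∞} (hp : 1 ≤ p) (hT : 0 ≤ T) :
    eLqLpNorm 1 p w (Ioo 0 T) = ENNReal.ofReal (∫ t in (0 : ℝ)..T, (eLpNorm (w t) p volume).toReal) := by
  rw [eLqLpNorm_one_eq_lintegral hw, lintegral_eLpNorm_eq_ofReal_integral hw hp hT]

end MixedAsIntegral

/-! ## The sets carrying the concentrated stress -/

section Sets

variable {T τ : ℝ} {n : ℕ}

/-- The `τ`-neighbourhood of the interior nodes, `⋃_{1 ≤ j < n} (tⱼ - τ, tⱼ + τ)`: outside it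
every cut-off is identically `0` or `1`. [folklore] -/
def nearNodes (T : ℝ) (n : ℕ) (τ : ℝ) : Set ℝ :=
  ⋃ j ∈ Finset.Ico 1 n, Ioo (node T n j - τ) (node T n j + τ)

/-- `nearNodes` is measurable. [folklore] -/
theorem measurableSet_nearNodes : MeasurableSet (nearNodes T n τ) :=
  Finset.measurableSet_biUnion _ fun _ _ => measurableSet_Ioo

/-- `|nearNodes| ≤ 2nτ` (CL22, proof of Prop. 3.3: "`‖1 - ∑ᵢχᵢ‖_{L¹} ≲ τ^{1-ε}`"). [cite: CheskidovLuo2022, Prop. 3.3 (proof)] -/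
theorem volume_nearNodes_le : volume (nearNodes T n τ) ≤ ENNReal.ofReal (2 * n * τ) := by
  unfold nearNodes
  refine (measure_biUnion_finset_le _ _).trans ?_
  have h1 : ∀ j ∈ Finset.Ico 1 n, volume (Ioo (node T n j - τ) (node T n j + τ)) = ENNReal.ofReal (2 * τ) := by
    intro j _
    rw [Real.volume_Ioo]; congr 1; ring
  rw [Finset.sum_congr rfl h1, Finset.sum_const, Nat.card_Ico, nsmul_eq_mul]
  calc ((n - 1 : ℕ) : ℝ≥0∞) * ENNReal.ofReal (2 * τ) ≤ (n : ℝ≥0∞) * ENNReal.ofReal (2 * τ) := by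
        gcongr; exact_mod_cast Nat.sub_le n 1
    _ = ENNReal.ofReal (2 * n * τ) := by
        rw [← ENNReal.ofReal_natCast, ← ENNReal.ofReal_mul (Nat.cast_nonneg _)]
        congr 1; ring

/-- At a time of the `i`-th grid interval, either `χᵢ = 1` or the time is `τ`-close to an
interior node. [folklore] -/
theorem cutoff_eq_one_or_mem_nearNodes (hτ : 0 < τ) {i : ℕ} (hi : i < n) {t : ℝ}
    (ht : t ∈ Icc (node T n i) (node T n (i + 1))) :
    cutoff T n τ i t = 1 ∨ t ∈ nearNodes T n τ := by
  by_cases hl : i = 0 ∨ node T n i + 3 * τ / 4 ≤ t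
  · by_cases hr : i + 1 = n ∨ t ≤ node T n (i + 1) - 3 * τ / 4
    · exact Or.inl (cutoff_eq_one hτ hl hr)
    · right
      rw [not_or, not_le] at hr
      refine mem_iUnion₂.2 ⟨i + 1, Finset.mem_Ico.2 ⟨Nat.succ_le_succ (Nat.zero_le _),
        lt_of_le_of_ne (Nat.succ_le_of_lt hi) hr.1⟩, ?_, ?_⟩
      · linarith [hr.2]
      · linarith [ht.2]
  · right
    rw [not_or, not_le] at hl
    refine mem_iUnion₂.2 ⟨i, Finset.mem_Ico.2 ⟨Nat.one_le_iff_ne_zero.2 hl.1, hi⟩, ?_, ?_⟩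
    · linarith [ht.1]
    · linarith [hl.2]

/-- `|1 - χᵢ(t)| ≤ 𝟙_{nearNodes}(t)` on the `i`-th grid interval. [folklore] -/
theorem ofReal_abs_one_sub_cutoff_le (hτ : 0 < τ) {i : ℕ} (hi : i < n) {t : ℝ}
    (ht : t ∈ Icc (node T n i) (node T n (i + 1))) :
    ENNReal.ofReal |1 - cutoff T n τ i t| ≤ (nearNodes T n τ).indicator (fun _ => (1 : ℝ≥0∞)) t := by
  rcases cutoff_eq_one_or_mem_nearNodes hτ hi ht with h1 | hm
  · rw [h1, sub_self, abs_zero, ENNReal.ofReal_zero]; exact bot_le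
  · rw [indicator_of_mem hm, ← ENNReal.ofReal_one]
    refine ENNReal.ofReal_le_ofReal ?_
    rw [abs_le]
    constructor <;> linarith [cutoff_nonneg T n τ i t, cutoff_le_one T n τ i t]

/-- `|χᵢ(t)² - χᵢ(t)| ≤ 𝟙_{nearNodes}(t)` on the `i`-th grid interval. [folklore] -/
theorem ofReal_abs_sq_sub_cutoff_le (hτ : 0 < τ) {i : ℕ} (hi : i < n) {t : ℝ}
    (ht : t ∈ Icc (node T n i) (node T n (i + 1))) :
    ENNReal.ofReal |cutoff T n τ i t ^ 2 - cutoff T n τ i t| ≤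
      (nearNodes T n τ).indicator (fun _ => (1 : ℝ≥0∞)) t := by
  rcases cutoff_eq_one_or_mem_nearNodes hτ hi ht with h1 | hm
  · rw [h1]; simp
  · rw [indicator_of_mem hm, ← ENNReal.ofReal_one]
    refine ENNReal.ofReal_le_ofReal ?_
    have h0 := cutoff_nonneg T n τ i t
    have h1 := cutoff_le_one T n τ i t
    rw [abs_le]
    constructor <;> nlinarith

/-- The two closed transition windows of `χⱼ`. [folklore] -/
def windows (T : ℝ) (n : ℕ) (τ : ℝ) (j : ℕ) : Set ℝ :=
  Icc (node T n j + τ / 2) (node T n j + 3 * τ / 4) ∪ Icc (node T n (j + 1) - 3 * τ / 4) (node T n (j + 1) - τ / 2)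

/-- The windows are measurable. [folklore] -/
theorem measurableSet_windows (j : ℕ) : MeasurableSet (windows T n τ j) :=
  measurableSet_Icc.union measurableSet_Icc

/-- The two windows have total length `≤ τ/2`. [folklore] -/
theorem volume_windows_le (hτ : 0 ≤ τ) (j : ℕ) : volume (windows T n τ j) ≤ ENNReal.ofReal (τ / 2) := by
  unfold windows
  refine (measure_union_le _ _).trans ?_
  rw [Real.volume_Icc, Real.volume_Icc, ← ENNReal.ofReal_add (by linarith) (by linarith)]
  refine ENNReal.ofReal_le_ofReal ?_
  ring_nf; exact le_rfl

/-- Off its windows the derivative of `χⱼ` vanishes. [folklore] -/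
theorem deriv_cutoff_eq_zero_of_not_mem_windows (hτ : 0 < τ) {j : ℕ} {t : ℝ} (ht : t ∉ windows T n τ j) :
    deriv (cutoff T n τ j) t = 0 := by
  simp only [windows, mem_union, mem_Icc, not_or, not_and_or, not_le] at ht
  exact deriv_cutoff_eq_zero hτ (Or.inr ht.1) (Or.inr ht.2)

/-- **`‖χⱼ'‖_{L¹} ≤ 4 M_S`**: the derivative is bounded by `8M_S/τ` and supported in two windows
of length `τ/4` (CL22, §3.2: "`‖∂ₜχᵢ‖_{L¹([0,1])} ≲ 1`"). [cite: CheskidovLuo2022, Prop. 3.3 (proof)] -/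
theorem lintegral_abs_deriv_cutoff_le (hτ : 0 < τ) (j : ℕ) (S : Set ℝ) :
    ∫⁻ t in S, ENNReal.ofReal |deriv (cutoff T n τ j) t| ≤ ENNReal.ofReal (4 * cutoffDerivBound) := by
  have hle : ∀ t, ENNReal.ofReal |deriv (cutoff T n τ j) t| ≤
      (windows T n τ j).indicator (fun _ => ENNReal.ofReal (8 * cutoffDerivBound / τ)) t := by
    intro t
    by_cases ht : t ∈ windows T n τ j
    · rw [indicator_of_mem ht]
      exact ENNReal.ofReal_le_ofReal (abs_deriv_cutoff_le hτ j t)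
    · rw [indicator_of_notMem ht, deriv_cutoff_eq_zero_of_not_mem_windows hτ ht, abs_zero,
        ENNReal.ofReal_zero]
  calc ∫⁻ t in S, ENNReal.ofReal |deriv (cutoff T n τ j) t|
      ≤ ∫⁻ t, ENNReal.ofReal |deriv (cutoff T n τ j) t| := lintegral_mono' Measure.restrict_le_self le_rfl
    _ ≤ ∫⁻ t, (windows T n τ j).indicator (fun _ => ENNReal.ofReal (8 * cutoffDerivBound / τ)) t :=
        lintegral_mono hle
    _ = ENNReal.ofReal (8 * cutoffDerivBound / τ) * volume (windows T n τ j) :=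
        lintegral_indicator_const (measurableSet_windows j) _
    _ ≤ ENNReal.ofReal (8 * cutoffDerivBound / τ) * ENNReal.ofReal (τ / 2) := by
        gcongr; exact volume_windows_le hτ.le j
    _ = ENNReal.ofReal (4 * cutoffDerivBound) := by
        have hM : 0 ≤ cutoffDerivBound := zero_le_one.trans one_le_cutoffDerivBound
        rw [← ENNReal.ofReal_mul (by positivity)]
        congr 1; field_simp; ring

end Sets

/-! ## The `L¹_t L^p_x` estimate of the concentrated stress (CL22, Prop. 3.3) -/

section Estimate

variable {T τ r C K δ : ℝ} {n : ℕ}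
  {u : ℝ → UnitAddTorus d → EuclideanSpace ℝ d} {P : ℝ → UnitAddTorus d → ℝ}
  {R : ℝ → UnitAddTorus d → d → EuclideanSpace ℝ d}
  {v : ℕ → ℝ → UnitAddTorus d → EuclideanSpace ℝ d} {q : ℕ → ℝ → UnitAddTorus d → ℝ}
  {A : ℕ → ℝ → UnitAddTorus d → d → EuclideanSpace ℝ d} {π : ℕ → ℝ → UnitAddTorus d → ℝ}

variable (h : IsGlueData T n τ r C K δ u P R v q A π)
include h

/-- Minkowski for the three terms of the concentrated stress at a time of the `i`-th grid
interval. [folklore] -/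
theorem IsGlueData.eLpNorm_glueStress_le {p : ℝ≥0∞} (hp : 1 ≤ p) {i : ℕ} (hi : i < n) {t : ℝ}
    (ht : t ∈ Icc (node T n i) (node T n (i + 1))) :
    eLpNorm (glueStress T n τ R v A t) p volume ≤
      ENNReal.ofReal |1 - cutoff T n τ i t| * eLpNorm (R t) p volume +
        ENNReal.ofReal |deriv (cutoff T n τ i) t| * eLpNorm (A i t) p volume +
        ENNReal.ofReal |cutoff T n τ i t ^ 2 - cutoff T n τ i t| * eLpNorm (tracelessSq (v i t)) p volume := by
  have htT : t ∈ Icc 0 T := h.Icc_subset hi ht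
  set c : ℝ := cutoff T n τ i t
  set c' : ℝ := deriv (cutoff T n τ i) t
  have hS : glueStress T n τ R v A t = (1 - c) • R t + c' • A i t + (c ^ 2 - c) • tracelessSq (v i t) := by
    funext x j
    rw [h.glueStress_apply hi ht x j]
    simp only [Pi.add_apply, Pi.smul_apply]
    module
  have hRt : IsSmooth (R t) := h.nsr.smooth_stress.isSmooth_slice htT
  have hAt : IsSmooth (A i t) := (h.cor i hi).smooth_A.isSmooth_slice ht
  have hTt : IsSmooth (tracelessSq (v i t)) := ((h.cor i hi).smooth_v.isSmooth_slice ht).tracelessSq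
  have m1 : AEStronglyMeasurable ((1 - c) • R t) volume := (hRt.continuous.const_smul _).aestronglyMeasurable
  have m2 : AEStronglyMeasurable (c' • A i t) volume := (hAt.continuous.const_smul _).aestronglyMeasurable
  have m3 : AEStronglyMeasurable ((c ^ 2 - c) • tracelessSq (v i t)) volume :=
    (hTt.continuous.const_smul _).aestronglyMeasurable
  rw [hS]
  calc eLpNorm ((1 - c) • R t + c' • A i t + (c ^ 2 - c) • tracelessSq (v i t)) p volume
      ≤ eLpNorm ((1 - c) • R t + c' • A i t) p volume + eLpNorm ((c ^ 2 - c) • tracelessSq (v i t)) p volume :=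
        eLpNorm_add_le (m1.add m2) m3 hp
    _ ≤ eLpNorm ((1 - c) • R t) p volume + eLpNorm (c' • A i t) p volume +
          eLpNorm ((c ^ 2 - c) • tracelessSq (v i t)) p volume := by
        gcongr; exact eLpNorm_add_le m1 m2 hp
    _ = _ := by
        rw [eLpNorm_const_smul, eLpNorm_const_smul, eLpNorm_const_smul, Real.enorm_eq_ofReal_abs,
          Real.enorm_eq_ofReal_abs, Real.enorm_eq_ofReal_abs]

/-- The bound `Bⱼ = ofReal (C ∫_{tⱼ}^{tⱼ₊₁} ‖R‖_{L^r} + K)` of the antidivergence of the `j`-th corrector,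
as an extended real. [folklore] -/
def IsGlueData.abound (_ : IsGlueData T n τ r C K δ u P R v q A π) (j : ℕ) : ℝ≥0∞ :=
  ENNReal.ofReal (C * (∫ s in node T n j..node T n (j + 1), (eLpNorm (R s) (ENNReal.ofReal r) volume).toReal) + K)

/-- **Pointwise-in-time bound of the concentrated stress** by an explicit integrable profile:
the background term and the quadratic term live on `nearNodes`, the antidivergence term is
controlled by `∑ⱼ Bⱼ |χⱼ'|`. [cite: CheskidovLuo2022, Prop. 3.3 (proof)] -/
theorem IsGlueData.eLpNorm_glueStress_le_profile (hr : 1 ≤ r) (hδ : 0 ≤ δ) {MR : ℝ}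
    (hMR : ∀ t ∈ Icc 0 T, ∀ x, ‖R t x‖ ≤ MR) {t : ℝ} (ht : t ∈ Icc 0 T) :
    eLpNorm (glueStress T n τ R v A t) (ENNReal.ofReal r) volume ≤
      (nearNodes T n τ).indicator (fun _ => ENNReal.ofReal MR + ENNReal.ofReal (2 * δ ^ 2)) t +
        ∑ j ∈ Finset.range n, h.abound j * ENNReal.ofReal |deriv (cutoff T n τ j) t| := by
  have hp : (1 : ℝ≥0∞) ≤ ENNReal.ofReal r := ENNReal.one_le_ofReal.2 hr
  obtain ⟨i, hi, hti⟩ := exists_mem_Icc_node h.hT h.hn ht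
  have hc := h.cor i hi
  refine (h.eLpNorm_glueStress_le hp hi hti).trans ?_
  -- the three terms
  have h1 : ENNReal.ofReal |1 - cutoff T n τ i t| * eLpNorm (R t) (ENNReal.ofReal r) volume ≤
      (nearNodes T n τ).indicator (fun _ => ENNReal.ofReal MR) t := by
    calc ENNReal.ofReal |1 - cutoff T n τ i t| * eLpNorm (R t) (ENNReal.ofReal r) volume
        ≤ (nearNodes T n τ).indicator (fun _ => (1 : ℝ≥0∞)) t * ENNReal.ofReal MR :=
          mul_le_mul' (ofReal_abs_one_sub_cutoff_le h.hτ hi hti) (eLpNorm_le_of_forall_norm_le (hMR t ht) _)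
      _ = (nearNodes T n τ).indicator (fun _ => ENNReal.ofReal MR) t := by
          by_cases hm : t ∈ nearNodes T n τ <;> simp [hm]
  have h3 : ENNReal.ofReal |cutoff T n τ i t ^ 2 - cutoff T n τ i t| *
      eLpNorm (tracelessSq (v i t)) (ENNReal.ofReal r) volume ≤
      (nearNodes T n τ).indicator (fun _ => ENNReal.ofReal (2 * δ ^ 2)) t := by
    have hT2 : ∀ x, ‖tracelessSq (v i t) x‖ ≤ 2 * δ ^ 2 := fun x =>
      (norm_tracelessSq_le (v i t) x).trans (by
        have := hc.norm_le t hti x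
        nlinarith [norm_nonneg (v i t x)])
    calc ENNReal.ofReal |cutoff T n τ i t ^ 2 - cutoff T n τ i t| *
          eLpNorm (tracelessSq (v i t)) (ENNReal.ofReal r) volume
        ≤ (nearNodes T n τ).indicator (fun _ => (1 : ℝ≥0∞)) t * ENNReal.ofReal (2 * δ ^ 2) :=
          mul_le_mul' (ofReal_abs_sq_sub_cutoff_le h.hτ hi hti) (eLpNorm_le_of_forall_norm_le hT2 _)
      _ = (nearNodes T n τ).indicator (fun _ => ENNReal.ofReal (2 * δ ^ 2)) t := by
          by_cases hm : t ∈ nearNodes T n τ <;> simp [hm]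
  have h2 : ENNReal.ofReal |deriv (cutoff T n τ i) t| * eLpNorm (A i t) (ENNReal.ofReal r) volume ≤
      ∑ j ∈ Finset.range n, h.abound j * ENNReal.ofReal |deriv (cutoff T n τ j) t| := by
    calc ENNReal.ofReal |deriv (cutoff T n τ i) t| * eLpNorm (A i t) (ENNReal.ofReal r) volume
        ≤ ENNReal.ofReal |deriv (cutoff T n τ i) t| * h.abound i := by
          gcongr; exact hc.eLpNorm_le t hti
      _ = h.abound i * ENNReal.ofReal |deriv (cutoff T n τ i) t| := mul_comm _ _
      _ ≤ ∑ j ∈ Finset.range n, h.abound j * ENNReal.ofReal |deriv (cutoff T n τ j) t| :=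
          Finset.single_le_sum (f := fun j => h.abound j * ENNReal.ofReal |deriv (cutoff T n τ j) t|)
            (fun j _ => bot_le) (Finset.mem_range.2 hi)
  have hind : (nearNodes T n τ).indicator (fun _ => ENNReal.ofReal MR) t +
      (nearNodes T n τ).indicator (fun _ => ENNReal.ofReal (2 * δ ^ 2)) t =
      (nearNodes T n τ).indicator (fun _ => ENNReal.ofReal MR + ENNReal.ofReal (2 * δ ^ 2)) t := by
    by_cases hm : t ∈ nearNodes T n τ <;> simp [hm]
  calc _ ≤ (nearNodes T n τ).indicator (fun _ => ENNReal.ofReal MR) t +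
        (∑ j ∈ Finset.range n, h.abound j * ENNReal.ofReal |deriv (cutoff T n τ j) t|) +
        (nearNodes T n τ).indicator (fun _ => ENNReal.ofReal (2 * δ ^ 2)) t := add_le_add (add_le_add h1 h2) h3
    _ = _ := by rw [add_right_comm, hind]

/-- The sum of the antidivergence bounds: `∑ⱼ Bⱼ = ofReal (C ∫₀ᵀ ‖R‖_{L^r} + n K)`. [folklore] -/
theorem IsGlueData.sum_abound (hr : 1 ≤ r) (hC : 0 ≤ C) (hK : 0 ≤ K) :
    ∑ j ∈ Finset.range n, h.abound j =
      ENNReal.ofReal (C * (∫ s in (0 : ℝ)..T, (eLpNorm (R s) (ENNReal.ofReal r) volume).toReal) + n * K) := by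
  have hp : (1 : ℝ≥0∞) ≤ ENNReal.ofReal r := ENNReal.one_le_ofReal.2 hr
  have hcont := h.nsr.smooth_stress.continuousOn_eLpNorm_toReal hp
  set f : ℝ → ℝ := fun s => (eLpNorm (R s) (ENNReal.ofReal r) volume).toReal with hf
  have hnn : ∀ j, 0 ≤ ∫ s in node T n j..node T n (j + 1), f s := fun j =>
    intervalIntegral.integral_nonneg (h.node_lt j).le fun s _ => ENNReal.toReal_nonneg
  have hterm : ∀ j ∈ Finset.range n, 0 ≤ C * (∫ s in node T n j..node T n (j + 1), f s) + K :=
    fun j _ => add_nonneg (mul_nonneg hC (hnn j)) hK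
  unfold IsGlueData.abound
  rw [← ENNReal.ofReal_sum_of_nonneg hterm, Finset.sum_add_distrib, Finset.sum_const, Finset.card_range,
    nsmul_eq_mul, ← Finset.mul_sum]
  congr 2
  -- `∑ⱼ ∫_{tⱼ}^{tⱼ₊₁} = ∫₀ᵀ`
  have hadj := intervalIntegral.sum_integral_adjacent_intervals (f := f) (μ := volume) (a := node T n) (n := n)
    fun k hk => ((hcont.mono (h.Icc_subset hk)).intervalIntegrable_of_Icc (h.node_lt k).le)
  rw [hadj, node_zero, node_self T h.hn.ne']

/-- **The `L¹_t L^r_x` bound of the concentrated stress** (CL22, Prop. 3.3, proof: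
"`‖R̄‖_{L¹L^r} ≲ τ^{1-ε}‖R‖_{L^∞L^r} + ∑ᵢ(∫_{tᵢ}^{tᵢ₊₁}‖R‖_{L^r} + C_uδτ^ε) + δ²∑ᵢτ`"): with
`M_R = sup ‖R‖`, the corrector bound `‖Aᵢ(t)‖_{L^r} ≤ C∫_{tᵢ}^{tᵢ₊₁}‖R‖_{L^r} + K` and
`‖vᵢ‖ ≤ δ`,
`‖R̄‖_{L¹(0,T;L^r)} ≤ (M_R + 2δ²)·2nτ + 4M_S C ‖R‖_{L¹(0,T;L^r)} + 4M_S n K`.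
[cite: CheskidovLuo2022, Prop. 3.3] -/
theorem IsGlueData.eLqLpNorm_glueStress_le (hr : 1 ≤ r) (hδ : 0 ≤ δ) (hC : 0 ≤ C) (hK : 0 ≤ K)
    {MR : ℝ} (hMR : ∀ t ∈ Icc 0 T, ∀ x, ‖R t x‖ ≤ MR) :
    eLqLpNorm 1 (ENNReal.ofReal r) (glueStress T n τ R v A) (Ioo 0 T) ≤
      ENNReal.ofReal ((MR + 2 * δ ^ 2) * (2 * n * τ)) +
        ENNReal.ofReal (4 * cutoffDerivBound * C) * eLqLpNorm 1 (ENNReal.ofReal r) R (Ioo 0 T) +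
        ENNReal.ofReal (4 * cutoffDerivBound * (n * K)) := by
  have hp : (1 : ℝ≥0∞) ≤ ENNReal.ofReal r := ENNReal.one_le_ofReal.2 hr
  have hMR0 : 0 ≤ MR := (norm_nonneg _).trans (hMR 0 ⟨le_rfl, h.hT.le⟩ 0)
  have hM : 0 ≤ cutoffDerivBound := zero_le_one.trans one_le_cutoffDerivBound
  rw [eLqLpNorm_one_eq_lintegral h.smooth_glueStress, eLqLpNorm_one_eq_ofReal_integral h.nsr.smooth_stress hp h.hT.le]
  -- integrate the profile
  have hprof := fun t (ht : t ∈ Ioo 0 T) => h.eLpNorm_glueStress_le_profile hr hδ hMR (Ioo_subset_Icc_self ht)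
  have hmeas : ∀ j, Measurable fun t => ENNReal.ofReal |deriv (cutoff T n τ j) t| := fun j =>
    ENNReal.measurable_ofReal.comp (continuous_abs.measurable.comp
      (((contDiff_cutoff T n τ j).continuous_deriv (by simp)).measurable))
  calc ∫⁻ t in Ioo 0 T, eLpNorm (glueStress T n τ R v A t) (ENNReal.ofReal r) volume
      ≤ ∫⁻ t in Ioo 0 T, ((nearNodes T n τ).indicator (fun _ => ENNReal.ofReal MR + ENNReal.ofReal (2 * δ ^ 2)) t +
          ∑ j ∈ Finset.range n, h.abound j * ENNReal.ofReal |deriv (cutoff T n τ j) t|) :=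
        setLIntegral_mono' measurableSet_Ioo hprof
    _ = (∫⁻ t in Ioo 0 T, (nearNodes T n τ).indicator (fun _ => ENNReal.ofReal MR + ENNReal.ofReal (2 * δ ^ 2)) t) +
          ∑ j ∈ Finset.range n, h.abound j * ∫⁻ t in Ioo 0 T, ENNReal.ofReal |deriv (cutoff T n τ j) t| := by
        rw [lintegral_add_left ((measurable_const.indicator measurableSet_nearNodes)),
          lintegral_finsetSum' _ fun j _ => ((hmeas j).const_mul _).aemeasurable]
        congr 1
        refine Finset.sum_congr rfl fun j _ => ?_
        rw [lintegral_const_mul _ (hmeas j)]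
    _ ≤ (ENNReal.ofReal MR + ENNReal.ofReal (2 * δ ^ 2)) * ENNReal.ofReal (2 * n * τ) +
          ∑ j ∈ Finset.range n, h.abound j * ENNReal.ofReal (4 * cutoffDerivBound) := by
        gcongr with j hj
        · calc ∫⁻ t in Ioo 0 T, (nearNodes T n τ).indicator (fun _ => ENNReal.ofReal MR + ENNReal.ofReal (2 * δ ^ 2)) t
              ≤ ∫⁻ t, (nearNodes T n τ).indicator (fun _ => ENNReal.ofReal MR + ENNReal.ofReal (2 * δ ^ 2)) t :=
                lintegral_mono' Measure.restrict_le_self le_rfl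
            _ = (ENNReal.ofReal MR + ENNReal.ofReal (2 * δ ^ 2)) * volume (nearNodes T n τ) :=
                lintegral_indicator_const measurableSet_nearNodes _
            _ ≤ _ := by gcongr; exact volume_nearNodes_le
        · exact lintegral_abs_deriv_cutoff_le h.hτ j _
    _ = ENNReal.ofReal ((MR + 2 * δ ^ 2) * (2 * n * τ)) +
          ENNReal.ofReal (4 * cutoffDerivBound) *
            ENNReal.ofReal (C * (∫ s in (0 : ℝ)..T, (eLpNorm (R s) (ENNReal.ofReal r) volume).toReal) + n * K) := by
        rw [← Finset.sum_mul, h.sum_abound hr hC hK, mul_comm (ENNReal.ofReal (4 * _)),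
          ← ENNReal.ofReal_add hMR0 (by positivity), ← ENNReal.ofReal_mul (by positivity)]
    _ = _ := by
        have hI : 0 ≤ ∫ s in (0 : ℝ)..T, (eLpNorm (R s) (ENNReal.ofReal r) volume).toReal :=
          intervalIntegral.integral_nonneg h.hT.le fun s _ => ENNReal.toReal_nonneg
        have h4 : (0 : ℝ) ≤ 4 * cutoffDerivBound := by positivity
        rw [ENNReal.ofReal_add (mul_nonneg hC hI) (by positivity), ENNReal.ofReal_mul hC,
          ENNReal.ofReal_mul h4, ENNReal.ofReal_mul h4]
        ring

end Estimate

end Concentration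

end StressBound

end Torus

end Literature.Analysis.FluidPDE
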